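import Summits.AnomalousDissipation.AnomalousDissipation.Theorems.QuarticGate.Negative.EnergyRow
import Summits.AnomalousDissipation.AnomalousDissipation.Theorems.QuarticGate.Negative.Laminar

/-!
# Anatomy of `QuarticTightness` (negative-side lemmas; cdisprove seat of stmt-AnomalousDissipation-14331)

`MomentParity.QuarticTightness` (rank 5): for every admissible force `f`, every `ν_j → 0` and budgets
`E`, `ε > 0`, the GATE HYPOTHESIS `GateHyp f ν E ε` (the body of `QuarticGate`: loud 4-stationary
level-`N` laws with finite fourth moments, `N`-frequently at every `j`) implies, for some budgets
`E'`, `ε' > 0`, the LADDER CONCLUSION `LadderConcl f ν E' ε'` (the body of `MomentLadder` minus the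
resolution clause: loud bounded-support `d`-stationary level-`N` laws for every order `d`).
`quarticTightness_iff` restates the crux through these named clauses (`Iff.rfl`).

What is proved (sorry-free), for provers AND would-be refuters of the crux:

* SHAPE (`not_quarticTightness_iff`, `not_ladderConcl_iff`): a refutation is a force carrying the gate
  hypothesis (so it PROVES the rank-2 crux `QuarticGate` at that force) whose bounded Galerkin ensembles
  are quiet UNIFORMLY in large `N` along a subsequence of `ν_j` (a 3-D bounded-energy laminarisation
  theorem); `not_invariantFamily_of_not_ladderConcl`: it refutes the Galerkin-invariant loud family
  (body of `GalerkinInvariantLoud`) of its force.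
* BADGES (`IsInvariantWitness.isLadderWitness`, `IsLadderWitness.isQuarticWitness`,
  `gateHyp_of_ladderConcl`): invariant ⇒ ladder ⇒ gate; the conclusion of the crux implies its
  hypothesis with the same budgets (bounded support gives the fourth moments), so the crux asserts the
  EQUIVALENCE of the two badges up to constants.
* LOAD-BEARING `0 < ε` (`quarticTightness_false_without_epsPos`): without it `f = 0`, `δ₀` carry the
  hypothesis while the zero force has no loud ladder (energy row). No other clause can be tested today:
  every gate-witness family in the tree is quiet (`δ₀`) or fully invariant (laminar Kolmogorov Diracs).
* LADDER-SIDE FLOORS (`IsLadderWitness.eps_le_force`: `ε' ≤ ‖f‖₂√E'`; `IsLadderWitness.eps_le`: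
  `ε' ≤ 4π²N²νE'`; `IsLadderWitness.eps_le_radius`: `ε' ≤ ‖f‖₂R`; `not_ladderBoundedLevel`).
* THE CUBIC-CERTIFICATE BARRIER (weak duality: degree-`≤ 3` quietness certificates bound every gate
  witness, so no known laminarisation argument can refute the crux) is the companion file
  `Negative/CubicCertificateBarrier.lean`.
* FIXED VISCOSITY IS TRIVIAL (`isLadderWitness_dirac_kolState`,
  `gate_and_ladder_kolmogorov_fixedViscosity`): for `K_1 = cos(2πx₁)e₀` at fixed `ν` the laminar Dirac
  is a witness on both sides at every order; and with a `j`-DEPENDENT energy budget the conclusion holds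
  outright along every `ν_j → 0` (`ladderConcl_jDependentEnergy_kolmogorov`): the content of the crux is
  the `j`-uniform budget `E'`.
-/

namespace Summit.AnomalousDissipation.AnomalousDissipation.Theorems.QuarticTightness.Negative

set_option linter.dupNamespace false

open MeasureTheory Filter Topology
open scoped ENNReal InnerProductSpace RealInnerProductSpace
open Literature.Analysis.FunctionSpaces Literature.Analysis.FluidPDE
open Summit.AnomalousDissipation.AnomalousDissipation.Theses.MomentParity
open Summit.AnomalousDissipation.AnomalousDissipation.Theorems
open Summit.AnomalousDissipation.AnomalousDissipation.Theorems.QuarticGate.Negative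

noncomputable section

-- Type abbreviations `T3 = T³`, `R3 = ℝ³`, `H3 = H`, `L2T3 = L²(T³; ℝ³)` are the sibling crux's
-- (`Theorems/CubicParityLoud/Negative/Clauses.lean`).
open Summit.AnomalousDissipation.AnomalousDissipation.Theorems.CubicParityLoud.Negative (T3 R3 H3 L2T3)

/-! ## Vocabulary (verbatim clauses of `QuarticTightness`, named; gate side = `IsQuarticWitness`) -/

/-- Conclusion-side (ladder) witness at level `N`, support radius `R`, order `d`, budgets `E, ε`:
the verbatim clauses of the conclusion of `QuarticTightness` (= `MomentLadder` minus resolution). -/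
def IsLadderWitness (f : T3 → R3) (ν : ℝ) (N : ℕ) (R : ℝ) (d : ℕ) (E ε : ℝ) (μ : Measure H3) : Prop :=
  IsProbabilityMeasure μ ∧ (∀ᵐ u ∂μ, IsLevel N u) ∧ (∀ᵐ u ∂μ, ‖u‖ ≤ R) ∧
    IsPolyStationary ν f N d μ ∧ Torus.ensembleEnergy μ ≤ E ∧ ε ≤ Torus.ensembleDissipation ν μ

/-- Galerkin-INVARIANT loud witness (verbatim clauses of `GalerkinInvariantLoud`: all orders at once). -/
def IsInvariantWitness (f : T3 → R3) (ν : ℝ) (N : ℕ) (R E ε : ℝ) (μ : Measure H3) : Prop :=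
  IsProbabilityMeasure μ ∧ (∀ᵐ u ∂μ, IsLevel N u) ∧ (∀ᵐ u ∂μ, ‖u‖ ≤ R) ∧
    (∀ (m : ℕ) (g : Fin m → T3 → R3) (P : MvPolynomial (Fin m) ℝ), (∀ i, IsBandTest N (g i)) →
      Integrable (fun u => Torus.nsGeneratorPairing ν f u (polyGrad g P u)) μ ∧
        ∫ u, Torus.nsGeneratorPairing ν f u (polyGrad g P u) ∂μ = 0) ∧
    Torus.ensembleEnergy μ ≤ E ∧ ε ≤ Torus.ensembleDissipation ν μ

/-- The GATE HYPOTHESIS of the crux at `(f, ν, E, ε)`: the body of `QuarticGate`. -/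
def GateHyp (f : T3 → R3) (ν : ℕ → ℝ) (E ε : ℝ) : Prop :=
  ∀ j : ℕ, ∃ᶠ N in atTop, ∃ μ, IsQuarticWitness f (ν j) N E ε μ

/-- The LADDER CONCLUSION of the crux at `(f, ν, E, ε)`: the body of `MomentLadder` minus resolution. -/
def LadderConcl (f : T3 → R3) (ν : ℕ → ℝ) (E ε : ℝ) : Prop :=
  ∀ j : ℕ, ∃ R : ℝ, ∃ᶠ N in atTop, ∀ d : ℕ, ∃ μ, IsLadderWitness f (ν j) N R d E ε μ

/-- The Galerkin-invariant loud family at `(f, ν, E, ε)`: the body of `GalerkinInvariantLoud`. -/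
def InvariantFamily (f : T3 → R3) (ν : ℕ → ℝ) (E ε : ℝ) : Prop :=
  ∀ j : ℕ, ∃ R : ℝ, ∃ᶠ N in atTop, ∃ μ, IsInvariantWitness f (ν j) N R E ε μ

/-- `QuarticTightness` restated through the vocabulary (definitional unfolding, `Iff.rfl`). -/
theorem quarticTightness_iff :
    QuarticTightness ↔ ∀ f : T3 → R3, Torus.IsSmooth f → Torus.IsDivFree f → Torus.HasZeroMean f →
      ∀ (ν : ℕ → ℝ) (E ε : ℝ), (∀ j, 0 < ν j) → Tendsto ν atTop (𝓝 0) → 0 < ε →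
      GateHyp f ν E ε → ∃ E' ε' : ℝ, 0 < ε' ∧ LadderConcl f ν E' ε' :=
  Iff.rfl

/-- `GalerkinInvariantLoud` restated through the vocabulary (`Iff.rfl`). -/
theorem galerkinInvariantLoud_iff :
    GalerkinInvariantLoud ↔ ∃ f : T3 → R3, Torus.IsSmooth f ∧ Torus.IsDivFree f ∧ Torus.HasZeroMean f ∧
      ∃ (ν : ℕ → ℝ) (E ε : ℝ), (∀ j, 0 < ν j) ∧ Tendsto ν atTop (𝓝 0) ∧ 0 < ε ∧
      InvariantFamily f ν E ε :=
  Iff.rfl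

/-! ## A. Shape: what a refutation must prove -/

/-- **`¬ QuarticTightness` unfolded**: a refutation is a force and a viscosity sequence carrying the
gate hypothesis with NO loud ladder for any budgets. [folklore] -/
theorem not_quarticTightness_iff :
    ¬ QuarticTightness ↔ ∃ f : T3 → R3, Torus.IsSmooth f ∧ Torus.IsDivFree f ∧ Torus.HasZeroMean f ∧
      ∃ (ν : ℕ → ℝ) (E ε : ℝ), (∀ j, 0 < ν j) ∧ Tendsto ν atTop (𝓝 0) ∧ 0 < ε ∧
      GateHyp f ν E ε ∧ ∀ E' ε' : ℝ, 0 < ε' → ¬ LadderConcl f ν E' ε' := by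
  rw [quarticTightness_iff]
  push Not
  rfl

/-- **No loud ladder, unfolded**: at some viscosity index, for every radius, for all but finitely many
levels, some order admits no witness — UNIFORM-IN-`N` QUIETNESS of bounded Galerkin ensembles. [folklore] -/
theorem not_ladderConcl_iff {f : T3 → R3} {ν : ℕ → ℝ} {E ε : ℝ} :
    ¬ LadderConcl f ν E ε ↔
      ∃ j : ℕ, ∀ R : ℝ, ∀ᶠ N in atTop, ∃ d : ℕ, ∀ μ, ¬ IsLadderWitness f (ν j) N R d E ε μ := by
  simp only [LadderConcl, not_forall, not_exists, Filter.not_frequently]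

/-- The crux applied to the gate's own force: `QuarticTightness ∧ QuarticGate` give a loud ladder
(the zeroth-law-strength output the route wants; with `UniformResolution` it is `MomentLadder`). [folklore] -/
theorem ladderConcl_of_quarticTightness (h : QuarticTightness) (hG : QuarticGate) :
    ∃ f : T3 → R3, Torus.IsSmooth f ∧ Torus.IsDivFree f ∧ Torus.HasZeroMean f ∧
      ∃ (ν : ℕ → ℝ) (E ε : ℝ), (∀ j, 0 < ν j) ∧ Tendsto ν atTop (𝓝 0) ∧ 0 < ε ∧
      LadderConcl f ν E ε := by
  obtain ⟨f, hfs, hfd, hfz, ν, E, ε, hν, hν0, hε, hH⟩ := quarticGate_iff.1 hG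
  obtain ⟨E', ε', hε', hC⟩ := quarticTightness_iff.1 h f hfs hfd hfz ν E ε hν hν0 hε hH
  exact ⟨f, hfs, hfd, hfz, ν, E', ε', hν, hν0, hε', hC⟩

/-! ## B. Badges: invariant ⇒ ladder ⇒ gate (the conclusion implies the hypothesis) -/

/-- An invariant witness is a ladder witness at every order. [folklore] -/
theorem IsInvariantWitness.isLadderWitness {f : T3 → R3} {ν : ℝ} {N : ℕ} {R E ε : ℝ} {μ : Measure H3}
    (h : IsInvariantWitness f ν N R E ε μ) (d : ℕ) : IsLadderWitness f ν N R d E ε μ :=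
  ⟨h.1, h.2.1, h.2.2.1, fun m g P hg _ => h.2.2.2.1 m g P hg, h.2.2.2.2.1, h.2.2.2.2.2⟩

/-- A Galerkin-invariant loud family is a loud ladder (same budgets). [folklore] -/
theorem ladderConcl_of_invariantFamily {f : T3 → R3} {ν : ℕ → ℝ} {E ε : ℝ}
    (h : InvariantFamily f ν E ε) : LadderConcl f ν E ε := by
  intro j
  obtain ⟨R, hR⟩ := h j
  exact ⟨R, hR.mono fun N ⟨μ, hμ⟩ d => ⟨μ, hμ.isLadderWitness d⟩⟩

/-- **A disproof refutes the Galerkin-invariant loud family of its force** (for all budgets):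
the counterexample force has NO loud bounded Galerkin-invariant ensembles N-frequently along `ν_j`. [folklore] -/
theorem not_invariantFamily_of_not_ladderConcl {f : T3 → R3} {ν : ℕ → ℝ} {E ε : ℝ}
    (h : ¬ LadderConcl f ν E ε) : ¬ InvariantFamily f ν E ε :=
  fun h' => h (ladderConcl_of_invariantFamily h')

/-- Bounded support ⇒ all moments: `∀ᵐ ‖u‖ ≤ R` on a finite measure gives `‖u‖^p` integrable. [folklore] -/
theorem integrable_norm_pow_of_ae_le {μ : Measure H3} [IsFiniteMeasure μ] {R : ℝ}
    (h : ∀ᵐ u ∂μ, ‖u‖ ≤ R) (p : ℕ) : Integrable (fun u : H3 => ‖u‖ ^ p) μ := by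
  refine Integrable.mono' (integrable_const (max R 0 ^ p)) (continuous_norm.pow p).aestronglyMeasurable ?_
  filter_upwards [h] with u hu
  rw [Real.norm_eq_abs, abs_of_nonneg (by positivity)]
  exact pow_le_pow_left₀ (norm_nonneg _) (hu.trans (le_max_left _ _)) p

/-- **A ladder witness of order `≥ 4` IS a gate witness** (bounded support gives the fourth moment). [folklore] -/
theorem IsLadderWitness.isQuarticWitness {f : T3 → R3} {ν : ℝ} {N : ℕ} {R : ℝ} {d : ℕ} {E ε : ℝ}
    {μ : Measure H3} (h : IsLadderWitness f ν N R d E ε μ) (hd : 4 ≤ d) :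
    IsQuarticWitness f ν N E ε μ := by
  obtain ⟨hp, hl, hb, hs, hE, hD⟩ := h
  exact ⟨hp, hl, integrable_norm_pow_of_ae_le hb 4, hs.mono hd, hE, hD⟩

/-- **The conclusion implies the hypothesis** (same budgets): the crux asserts that the two badges
"loud order-4 pseudo-ensembles exist" and "loud bounded ensembles of every order exist" are EQUIVALENT
up to constants along `ν_j → 0`. [folklore] -/
theorem gateHyp_of_ladderConcl {f : T3 → R3} {ν : ℕ → ℝ} {E ε : ℝ} (h : LadderConcl f ν E ε) :
    GateHyp f ν E ε := by
  intro j
  obtain ⟨R, hR⟩ := h j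
  exact hR.mono fun N hN => by
    obtain ⟨μ, hμ⟩ := hN 4
    exact ⟨μ, hμ.isQuarticWitness le_rfl⟩

/-! ## C. Load-bearing `0 < ε` -/

/-- **Force floor on the ladder side**: a ladder witness of order `≥ 3` has `ε ≤ ‖f‖_{L²} √E`
(energy row + Cauchy–Schwarz; sibling `ensembleDissipation_le_of_polyStationary`). [folklore] -/
theorem IsLadderWitness.eps_le_force {f : T3 → R3} (hf : MemLp f 2 volume) {ν : ℝ} {N : ℕ} {R : ℝ}
    {d : ℕ} {E ε : ℝ} {μ : Measure H3} (h : IsLadderWitness f ν N R d E ε μ) (hd : 3 ≤ d) :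
    ε ≤ Real.sqrt (∫ x, ‖f x‖ ^ 2) * Real.sqrt E := by
  obtain ⟨hp, hl, hb, hs, hE, hD⟩ := h
  have h2 := integrable_norm_pow_of_ae_le hb 2
  calc ε ≤ Torus.ensembleDissipation ν μ := hD
    _ ≤ Real.sqrt (∫ x, ‖f x‖ ^ 2) * Real.sqrt (Torus.ensembleEnergy μ) :=
        ensembleDissipation_le_of_polyStationary f hf hl h2 hd hs
    _ ≤ Real.sqrt (∫ x, ‖f x‖ ^ 2) * Real.sqrt E := by gcongr

/-- **The zero force has no loud ladder** (any budgets, `ε > 0`). [folklore] -/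
theorem not_ladderConcl_zero_force {ν : ℕ → ℝ} {E ε : ℝ} (hε : 0 < ε) :
    ¬ LadderConcl (fun _ => 0) ν E ε := by
  intro h
  obtain ⟨R, hR⟩ := h 0
  obtain ⟨N, hN⟩ := hR.exists
  obtain ⟨μ, hμ⟩ := hN 3
  have := hμ.eps_le_force (memLp_const 0) le_rfl
  simp at this
  linarith

/-- WEAKENING (refuted): `QuarticTightness` without `0 < ε`. -/
def QuarticTightnessWithoutEpsPos : Prop :=
  ∀ f : T3 → R3, Torus.IsSmooth f → Torus.IsDivFree f → Torus.HasZeroMean f →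
    ∀ (ν : ℕ → ℝ) (E ε : ℝ), (∀ j, 0 < ν j) → Tendsto ν atTop (𝓝 0) →
    GateHyp f ν E ε → ∃ E' ε' : ℝ, 0 < ε' ∧ LadderConcl f ν E' ε'

/-- **`0 < ε` is load-bearing**: without it, `f = 0`, `ν_j = 1/(j+1)`, `E = ε = 0` and the Dirac mass
`δ₀` carry the gate hypothesis at every level (sibling `isQuarticWitness_dirac_zero`), while the zero
force has no loud ladder (energy row). The crux cannot manufacture loudness: any proof consumes
`ε > 0` through the energy row `ν∫‖∇u‖² = ∫(f,u)`. [folklore] -/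
theorem quarticTightness_false_without_epsPos : ¬ QuarticTightnessWithoutEpsPos := by
  intro h
  have hzero : (Torus.realTrigPoly (∅ : Finset (Fin 3 → ℤ)) (0 : (Fin 3 → ℤ) → EuclideanSpace ℂ (Fin 3)))
      = fun _ => 0 := Torus.realTrigPoly_zero ∅
  obtain ⟨E', ε', hε', hC⟩ := h (fun _ => 0) (Torus.isSmooth_const _)
    (by rw [← hzero]; exact Torus.isDivFree_realTrigPoly fun k hk => by simp at hk)
    (by simp [Torus.HasZeroMean]) (fun j => 1 / ((j : ℝ) + 1)) 0 0 (fun j => by positivity)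
    tendsto_one_div_add_atTop_nhds_zero_nat
    (fun j => Frequently.of_forall fun N => ⟨_, isQuarticWitness_dirac_zero _ (by positivity) N⟩)
  exact not_ladderConcl_zero_force hε' hC

/-! ## D. Floors on the ladder side (briefing for provers of the crux) -/

/-- **Level ceiling on the ladder side**: `ε ≤ 4π² N² ν E` for every ladder witness (any order `d`,
stationarity not used). [folklore] -/
theorem IsLadderWitness.eps_le {f : T3 → R3} {ν : ℝ} (hν : 0 ≤ ν) {N : ℕ} {R : ℝ} {d : ℕ} {E ε : ℝ}
    {μ : Measure H3} (h : IsLadderWitness f ν N R d E ε μ) : ε ≤ 4 * Real.pi ^ 2 * (N : ℝ) ^ 2 * ν * E := by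
  obtain ⟨hp, hl, hb, -, hE, hD⟩ := h
  have hdiss := ensembleDissipation_le_of_level hν hl (integrable_norm_pow_of_ae_le hb 2)
  have hE0 : 0 ≤ Torus.ensembleEnergy μ := integral_nonneg fun u => by positivity
  calc ε ≤ Torus.ensembleDissipation ν μ := hD
    _ ≤ 4 * Real.pi ^ 2 * (N : ℝ) ^ 2 * ν * Torus.ensembleEnergy μ := hdiss
    _ ≤ 4 * Real.pi ^ 2 * (N : ℝ) ^ 2 * ν * E := by gcongr

/-- **Radius floor**: a ladder witness of order `≥ 3` has `ε ≤ ‖f‖_{L²} R` — the support radius is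
at least `ε/‖f‖₂`; for genuine invariant laws `R` is the absorbing radius `∼ ‖f‖₂/(4π²ν_j)`, so the
`∃ R` of the conclusion must be allowed to depend on `j`. [folklore] -/
theorem IsLadderWitness.eps_le_radius {f : T3 → R3} (hf : MemLp f 2 volume) {ν : ℝ} {N : ℕ} {R : ℝ}
    {d : ℕ} {E ε : ℝ} {μ : Measure H3} (h : IsLadderWitness f ν N R d E ε μ) (hd : 3 ≤ d) :
    ε ≤ Real.sqrt (∫ x, ‖f x‖ ^ 2) * R := by
  obtain ⟨hp, hl, hb, hs, hE, hD⟩ := h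
  have h2 := integrable_norm_pow_of_ae_le hb 2
  have hR : 0 ≤ R := by
    obtain ⟨u, hu⟩ := (hb.and (ae_of_all μ fun u => norm_nonneg u)).exists
    exact hu.2.trans hu.1
  have hEn : Torus.ensembleEnergy μ ≤ R ^ 2 := by
    unfold Torus.ensembleEnergy
    calc ∫ u, ‖u‖ ^ 2 ∂μ ≤ ∫ _u, R ^ 2 ∂μ :=
          integral_mono_ae h2 (integrable_const _) (hb.mono fun u hu => by
            exact pow_le_pow_left₀ (norm_nonneg _) hu 2)
      _ = R ^ 2 := by simp
  calc ε ≤ Torus.ensembleDissipation ν μ := hD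
    _ ≤ Real.sqrt (∫ x, ‖f x‖ ^ 2) * Real.sqrt (Torus.ensembleEnergy μ) :=
        ensembleDissipation_le_of_polyStationary f hf hl h2 hd hs
    _ ≤ Real.sqrt (∫ x, ‖f x‖ ^ 2) * Real.sqrt (R ^ 2) := by gcongr
    _ = Real.sqrt (∫ x, ‖f x‖ ^ 2) * R := by rw [Real.sqrt_sq hR]

/-- At a FIXED level, ladder witnesses die eventually in `j` (any radius, any order). [folklore] -/
theorem eventually_not_isLadderWitness (f : T3 → R3) {ν : ℕ → ℝ} (hν : ∀ j, 0 < ν j)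
    (hν0 : Tendsto ν atTop (𝓝 0)) (E : ℝ) {ε : ℝ} (hε : 0 < ε) (N : ℕ) :
    ∀ᶠ j in atTop, ∀ R d μ, ¬ IsLadderWitness f (ν j) N R d E ε μ := by
  set C : ℝ := 4 * Real.pi ^ 2 * (N : ℝ) ^ 2 * max E 0 + 1 with hC
  have hCpos : 0 < C := by positivity
  have hev : ∀ᶠ j in atTop, ν j < ε / C := (tendsto_order.1 hν0).2 _ (div_pos hε hCpos)
  refine hev.mono fun j hj R d μ hw => ?_
  have h1 := hw.eps_le (hν j).le
  have h2 : 4 * Real.pi ^ 2 * (N : ℝ) ^ 2 * ν j * E ≤ ν j * (C - 1) := by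
    have : 4 * Real.pi ^ 2 * (N : ℝ) ^ 2 * ν j * E ≤ 4 * Real.pi ^ 2 * (N : ℝ) ^ 2 * ν j * max E 0 := by
      gcongr
      · exact mul_nonneg (by positivity) (hν j).le
      · exact le_max_left _ _
    rw [hC]; nlinarith [this]
  have h3 : ν j * (C - 1) < ε := by
    have := (lt_div_iff₀ hCpos).1 hj
    nlinarith [(hν j).le]
  linarith

/-- STRENGTHENING OF THE CONCLUSION (refuted unconditionally): a loud ladder with the level chosen
BEFORE `j` (even only frequently in `j`). So on the conclusion side, too, `N ≳ ν_j^{-1/2}`. [folklore] -/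
theorem not_ladderBoundedLevel :
    ¬ ∃ (f : T3 → R3) (ν : ℕ → ℝ) (E ε : ℝ), (∀ j, 0 < ν j) ∧ Tendsto ν atTop (𝓝 0) ∧ 0 < ε ∧
      ∃ (N : ℕ) (R : ℝ), ∃ᶠ j in atTop, ∃ d μ, IsLadderWitness f (ν j) N R d E ε μ := by
  rintro ⟨f, ν, E, ε, hν, hν0, hε, N, R, hfreq⟩
  obtain ⟨j, ⟨d, μ, hμ⟩, hno⟩ :=
    (hfreq.and_eventually (eventually_not_isLadderWitness f hν hν0 E hε N)).exists
  exact hno R d μ hμ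

/-! ## F. Fixed viscosity is trivial: the laminar Kolmogorov Dirac is a witness on BOTH sides -/

/-- **At fixed `ν > 0` the Kolmogorov force `K_1 = cos(2πx₁)e₀` carries a gate witness AND a ladder
witness of every order at every level `N ≥ 1`**: the laminar Dirac `δ_{K_a}`, `a = (4π²ν)⁻¹`, with
`R = ‖K_a‖_H`, `E = a²/2`, `ε = (8π²ν)⁻¹` (sibling `isQuarticWitness_dirac_kolState`,
`isPolyStationary_dirac_kolState`). The implication of the crux is therefore pointwise-in-`ν` trivial for
this force; its content is the `j`-uniform energy budget `E'` as `ν_j → 0` (here `E ∝ ν⁻²`). [folklore] -/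
theorem isLadderWitness_dirac_kolState {ν : ℝ} (hν : 0 < ν) {N : ℕ} (hN : 1 ≤ N) (d : ℕ) :
    IsLadderWitness (kolField 1) ν N ‖kolState (4 * Real.pi ^ 2 * ν)⁻¹‖ d
      ((4 * Real.pi ^ 2 * ν)⁻¹ ^ 2 / 2) (8 * Real.pi ^ 2 * ν)⁻¹
      (Measure.dirac (kolState (4 * Real.pi ^ 2 * ν)⁻¹)) := by
  haveI : MeasurableSingletonClass (Torus.energySpace (Fin 3)) :=
    OpensMeasurableSpace.toMeasurableSingletonClass
  obtain ⟨⟨hp, hl, -, hs, hE, hD⟩, -⟩ := isQuarticWitness_dirac_kolState hν hN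
  have hforce : kolField 1 = kolField (4 * Real.pi ^ 2 * ν * (4 * Real.pi ^ 2 * ν)⁻¹) := by
    rw [mul_inv_cancel₀ (by positivity)]
  refine ⟨hp, hl, ?_, ?_, hE, hD⟩
  · rw [ae_dirac_eq]; simp
  · rw [hforce]; exact isPolyStationary_dirac_kolState ν _ N d

/-- Monotonicity of the ladder clauses in the loudness floor. [folklore] -/
theorem IsLadderWitness.mono_eps {f : T3 → R3} {ν : ℝ} {N : ℕ} {R : ℝ} {d : ℕ} {E ε ε' : ℝ}
    {μ : Measure H3} (h : IsLadderWitness f ν N R d E ε μ) (hε : ε' ≤ ε) :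
    IsLadderWitness f ν N R d E ε' μ :=
  ⟨h.1, h.2.1, h.2.2.1, h.2.2.2.1, h.2.2.2.2.1, hε.trans h.2.2.2.2.2⟩

/-- **WEAKENING OF THE CONCLUSION that holds outright (hypothesis unused): `E'` allowed to depend on
`j`.** Along EVERY positive `ν_j → 0` the Kolmogorov force `K_1` has loud ladders of every order at every
level `N ≥ 1` with a `j`-UNIFORM floor `ε' = (8π² sup_j ν_j)⁻¹` but energies `E'_j = (4π²ν_j)⁻²/2 → ∞`
(laminar Diracs). So the `j`-uniform energy budget `E'` carries the entire content of the conclusion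
(cf. sibling `quarticGateWithoutEnergyCeiling_holds` on the hypothesis side). [folklore] -/
theorem ladderConcl_jDependentEnergy_kolmogorov {ν : ℕ → ℝ} (hν : ∀ j, 0 < ν j)
    (hν0 : Tendsto ν atTop (𝓝 0)) :
    ∃ ε' : ℝ, 0 < ε' ∧ ∀ j : ℕ, ∃ (E' R : ℝ), ∃ᶠ N in atTop, ∀ d : ℕ, ∃ μ,
      IsLadderWitness (kolField 1) (ν j) N R d E' ε' μ := by
  obtain ⟨M, hM⟩ := hν0.bddAbove_range
  have hM' : ∀ j, ν j ≤ M := fun j => hM ⟨j, rfl⟩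
  have hMpos : 0 < M := (hν 0).trans_le (hM' 0)
  have hpi : 0 < Real.pi := Real.pi_pos
  refine ⟨(8 * Real.pi ^ 2 * M)⁻¹, by positivity, fun j => ⟨_, _,
    (eventually_ge_atTop 1).frequently.mono fun N hN d =>
      ⟨_, (isLadderWitness_dirac_kolState (hν j) hN d).mono_eps ?_⟩⟩⟩
  have hνj := hν j
  exact inv_anti₀ (by positivity) (by nlinarith [hM' j, hpi])

/-- Hence, at a single fixed viscosity, gate hypothesis and ladder conclusion BOTH hold for `K_1`
(frequently — indeed eventually — in `N`). [folklore] -/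
theorem gate_and_ladder_kolmogorov_fixedViscosity {ν : ℝ} (hν : 0 < ν) :
    (∃ᶠ N in atTop, ∃ μ, IsQuarticWitness (kolField 1) ν N ((4 * Real.pi ^ 2 * ν)⁻¹ ^ 2 / 2)
        (8 * Real.pi ^ 2 * ν)⁻¹ μ) ∧
    (∃ R : ℝ, ∃ᶠ N in atTop, ∀ d : ℕ, ∃ μ, IsLadderWitness (kolField 1) ν N R d
        ((4 * Real.pi ^ 2 * ν)⁻¹ ^ 2 / 2) (8 * Real.pi ^ 2 * ν)⁻¹ μ) :=
  ⟨(eventually_ge_atTop 1).frequently.mono fun _ hN => ⟨_, (isQuarticWitness_dirac_kolState hν hN).1⟩,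
    ⟨_, (eventually_ge_atTop 1).frequently.mono fun _ hN d => ⟨_, isLadderWitness_dirac_kolState hν hN d⟩⟩⟩

end

end Summit.AnomalousDissipation.AnomalousDissipation.Theorems.QuarticTightness.Negative
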